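import Literature.NumberTheory.NumberFields.RayClassFieldAdicCharacter
import Literature.NumberTheory.GaloisRepresentations.ArtinCharacterLocalGlobalProofs
import Literature.NumberTheory.GaloisRepresentations.LubinTateReciprocity
import Literature.NumberTheory.GaloisRepresentations.WeilLAdicCharacterLocalShape
import HarnessLib

/-!
# The ray adic character on the LOCAL inertia at `v`: `κ_v(res w) = Art_v(w)⁻¹ = χ_π(w)⁻¹`
# (local–global compatibility of class field theory + Lubin–Tate reciprocity)

For `K` totally complex, `𝔪 ≠ 0`, `v ∤ 𝔪`, `w_𝔪 = 1`, the ray adic character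
`κ_v = rayAdicCharacter h𝔪 hv hw : Gal(K̄/K(𝔪)) →* 𝒪_vˣ` (`RayClassFieldAdicCharacter.lean`; de Shalit's
`κ` of I.3.3 (9) / II.1.7 up to the reciprocity sign) is defined GLOBALLY (`σ|_{K(𝔪vⁿ)} = [⟨κσ⟩_v, K]`).
The Coleman / Lubin–Tate side of de Shalit II.4 (the tree's `LubinTateColeman*`, `lubinTateChar`) lives on
the LOCAL Galois group `Γ_{K_v}`. THIS FILE is the junction on inertia: for a local Weil element
`w ∈ I_{K_v} ⊆ W_{K_v}` with global image `res w = absGaloisRestrict K K_v (toAbsGalois w) ∈ Γ_K` and any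
local Artin map `a` (`IsLocalArtinMap`, e.g. THE pinned `canonicalArtin K_v`):

* `absGaloisRestrict_toAbsGalois_mem_ker_rayClassField` — `res w ∈ Gal(K̄/K(𝔪))` (`K(𝔪)/K` is unramified
  at `v ∤ 𝔪`: `ψ_{K(𝔪)|K}(⟨a w⟩_v) = 1`, and `(res w)|_L = ψ_{L|K}(⟨a w⟩_v)⁻¹`, Neukirch VI (5.6), tree
  `artinIdeleMap_localUnits_mul_absRestrictNormalHom`);
* `isAdicArtinValue_inv_of_mem_inertia` — `a(w)⁻¹ ∈ 𝒪_vˣ` is a `v`-adic Artin value of `res w` (every level);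
* ★ `rayAdicCharacter_absGaloisRestrict_eq_inv` — **`κ_v(res w) = a(w)⁻¹`**; with THE Artin map and
  Lubin–Tate reciprocity (`coe_lubinTateChar_toAbsGalois_canonicalArtin`: `χ_π = Art` on inertia):
  ★ `coe_rayAdicCharacter_absGaloisRestrict_inv_eq_lubinTateChar` — **`κ_v(res w)⁻¹ = χ_π(w)` in `K_v`** for
  EVERY uniformiser `π` of `K_v` — de Shalit's `κ` IS the Lubin–Tate character on the inertia group at `𝔭`
  (II.1.7, II.4.3: the action on `𝔭^∞`-division points), in the tree's sign conventions.

Theorems only; no `sorry`.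

## References
* [NeukirchANT1999] J. Neukirch, *Algebraic Number Theory* (1999), Ch. VI §5 Prop. (5.6), §7 (7.1).
* [CasselsFrohlichANT1967] Cassels–Fröhlich (1967), Ch. VI §3.7 Thm. 3 (Lubin–Tate), Ch. VII §5.
* [deShalit1987] E. de Shalit, *Iwasawa theory of elliptic curves with complex multiplication* (1987),
  I.3.3 (9) (p. 18), II.1.7 (p. 41), II.4.3 (p. 57).
* [LubinTate1965] J. Lubin, J. Tate, *Formal complex multiplication in local fields* (1965), Thm. 3.
-/

noncomputable section

open NumberField IsDedekindDomain IsDedekindDomain.HeightOneSpectrum Field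
open scoped nonZeroDivisors Classical

namespace Literature.NumberTheory.NumberFields

open Literature.NumberTheory.GaloisRepresentations
open Literature.NumberTheory.GaloisRepresentations.ArtinLocalGlobal

variable {K : Type} [Field K] [NumberField K] {𝔪 : Ideal (𝓞 K)} {v : HeightOneSpectrum (𝓞 K)}
  {a : WeilGroup (v.adicCompletion K) →* (v.adicCompletion K)ˣ}

/-! ### §1. Inertia elements: `a(w)` is a unit; `res w` fixes `K(𝔪)` -/

/-- On inertia a local Artin map takes unit values: `|a(w)|_v = 1`.
[cite: NeukirchANT1999, Ch. VI §5 Prop. (5.6)] [cite: CasselsFrohlichANT1967, Ch. VI §3.7 Thm. 3] -/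
theorem valued_artin_eq_one_of_mem_inertia (ha : IsLocalArtinMap (v.adicCompletion K) a)
    {w : WeilGroup (v.adicCompletion K)} (hwI : w ∈ WeilGroup.inertia (v.adicCompletion K)) :
    Valued.v ((a w : (v.adicCompletion K)ˣ) : v.adicCompletion K) = 1 := by
  have hunit : a w ∈ (ValuativeRel.valuation (v.adicCompletion K)).valuationSubring.unitGroup := by
    rw [← ha.image_inertia]; exact Subgroup.mem_map_of_mem a hwI
  rw [Valuation.mem_unitGroup_iff] at hunit
  exact (ValuativeRel.isEquiv (Valued.v : Valuation (v.adicCompletion K) (WithZero (Multiplicative ℤ)))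
    (ValuativeRel.valuation (v.adicCompletion K))).eq_one_iff_eq_one.mpr hunit

/-- The unit `a(w) ∈ 𝒪_vˣ` of an inertia element. [cite: NeukirchANT1999, Ch. VI §5 Prop. (5.6)] -/
theorem exists_unitsMap_eq_artin_of_mem_inertia (ha : IsLocalArtinMap (v.adicCompletion K) a)
    {w : WeilGroup (v.adicCompletion K)} (hwI : w ∈ WeilGroup.inertia (v.adicCompletion K)) :
    ∃ u : (v.adicCompletionIntegers K)ˣ,
      Units.map ((v.adicCompletionIntegers K).subtype : _ →* _) u = a w :=
  HeckeCharacter.exists_unitsMap_eq_of_valued_eq_one _ (valued_artin_eq_one_of_mem_inertia ha hwI)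

/-- **`(res w)|_L = ψ_{L|K}(⟨u⁻¹⟩_v)` for `u = a(w)`** and every finite abelian `L ⊆ K̄` (local–global
compatibility, inverted). [cite: NeukirchANT1999, Ch. VI §5 Prop. (5.6)] -/
theorem absRestrictNormalHom_absGaloisRestrict_toAbsGalois_eq_abRestrict (ha : IsLocalArtinMap (v.adicCompletion K) a)
    (L : IntermediateField K (AlgebraicClosure K)) [FiniteDimensional K L] [IsAbelianGalois K L]
    (w : WeilGroup (v.adicCompletion K)) {u : (v.adicCompletionIntegers K)ˣ}
    (hu : Units.map ((v.adicCompletionIntegers K).subtype : _ →* _) u = a w) :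
    absRestrictNormalHom L (absGaloisRestrict K (v.adicCompletion K)
        (WeilGroup.toAbsGalois (v.adicCompletion K) w)) =
      abRestrict L (ideleArtinMap K
        (localUnits v (Units.map ((v.adicCompletionIntegers K).subtype : _ →* _) u⁻¹))) := by
  haveI : NumberField L := NumberField.of_module_finite K L
  have key := artinIdeleMap_localUnits_mul_absRestrictNormalHom v L ha w
  rw [mul_eq_one_iff_inv_eq] at key
  rw [← key, ← hu, abRestrict_ideleArtinMap, map_inv, map_inv, map_inv]

/-- **`res w ∈ Gal(K̄/K(𝔪))` for `w ∈ I_{K_v}`, `v ∤ 𝔪`** (`K(𝔪)/K` is unramified at `v`: the idele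
`⟨a(w)⁻¹⟩_v` lies in `W_𝔪`). [cite: NeukirchANT1999, Ch. VI §7 Thm. (7.1), §5 Prop. (5.6)] -/
theorem absGaloisRestrict_toAbsGalois_mem_ker_rayClassField (h𝔪 : 𝔪 ≠ ⊥) (hv : ¬ 𝔪 ≤ v.asIdeal)
    (ha : IsLocalArtinMap (v.adicCompletion K) a) {w : WeilGroup (v.adicCompletion K)}
    (hwI : w ∈ WeilGroup.inertia (v.adicCompletion K)) :
    absGaloisRestrict K (v.adicCompletion K) (WeilGroup.toAbsGalois (v.adicCompletion K) w) ∈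
      (absRestrictNormalHom (rayClassField K 𝔪)).ker := by
  obtain ⟨u, hu⟩ := exists_unitsMap_eq_artin_of_mem_inertia ha hwI
  rw [MonoidHom.mem_ker, absRestrictNormalHom_absGaloisRestrict_toAbsGalois_eq_abRestrict ha (rayClassField K 𝔪) w hu,
    abRestrict_ideleArtinMap_rayClassField_eq_one_iff]
  refine Subgroup.mem_sup_right ?_
  have h := (localUnits_integer_mem_rayUnitIdeles_mul_pow_iff h𝔪 hv 0 u⁻¹).mpr (by
    rw [Nat.cast_zero, neg_zero, WithZero.exp_zero]
    have h1 : Valued.v ((((u⁻¹ : (v.adicCompletionIntegers K)ˣ) : v.adicCompletionIntegers K) :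
        v.adicCompletion K)) ≤ 1 := ((u⁻¹ : (v.adicCompletionIntegers K)ˣ) : v.adicCompletionIntegers K).2
    have h2 : Valued.v (1 : v.adicCompletion K) ≤ 1 := by rw [map_one]
    exact (Valuation.map_sub _ _ _).trans (max_le h1 h2))
  rwa [pow_zero, mul_one] at h

/-! ### §2. `κ_v(res w) = a(w)⁻¹` -/

/-- **`a(w)⁻¹` is a `v`-adic Artin value of `res w`** at every level `K(𝔪vⁿ)`.
[cite: NeukirchANT1999, Ch. VI §5 Prop. (5.6)] [cite: deShalit1987, II.1.7 (p. 41)] -/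
theorem isAdicArtinValue_inv_of_mem_inertia (ha : IsLocalArtinMap (v.adicCompletion K) a)
    (w : WeilGroup (v.adicCompletion K)) {u : (v.adicCompletionIntegers K)ˣ}
    (hu : Units.map ((v.adicCompletionIntegers K).subtype : _ →* _) u = a w) :
    IsAdicArtinValue 𝔪 v (absGaloisRestrict K (v.adicCompletion K)
      (WeilGroup.toAbsGalois (v.adicCompletion K) w)) u⁻¹ :=
  fun n ↦ absRestrictNormalHom_absGaloisRestrict_toAbsGalois_eq_abRestrict ha (rayClassField K (𝔪 * v.asIdeal ^ n)) w hu

variable [IsTotallyComplex K]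

/-- ★ **`κ_v(res w) = a(w)⁻¹`**: on the inertia group at `v` the ray adic character is the INVERSE of
the local Artin map (`K` totally complex, `𝔪 ≠ 0`, `v ∤ 𝔪`, `w_𝔪 = 1`).
[cite: deShalit1987, I.3.3 (9) (p. 18), II.1.7 (p. 41)] [cite: NeukirchANT1999, Ch. VI §5 Prop. (5.6)] -/
theorem rayAdicCharacter_absGaloisRestrict_eq_inv (h𝔪 : 𝔪 ≠ ⊥) (hv : ¬ 𝔪 ≤ v.asIdeal)
    (hw : ∀ u : (𝓞 K)ˣ, (u : 𝓞 K) - 1 ∈ 𝔪 → u = 1) (ha : IsLocalArtinMap (v.adicCompletion K) a)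
    {w : WeilGroup (v.adicCompletion K)} (hwI : w ∈ WeilGroup.inertia (v.adicCompletion K))
    {u : (v.adicCompletionIntegers K)ˣ}
    (hu : Units.map ((v.adicCompletionIntegers K).subtype : _ →* _) u = a w) :
    rayAdicCharacter h𝔪 hv hw ⟨absGaloisRestrict K (v.adicCompletion K)
        (WeilGroup.toAbsGalois (v.adicCompletion K) w),
      absGaloisRestrict_toAbsGalois_mem_ker_rayClassField h𝔪 hv ha hwI⟩ = u⁻¹ :=
  rayAdicCharacter_eq_of_isAdicArtinValue h𝔪 hv hw (isAdicArtinValue_inv_of_mem_inertia ha w hu)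

/-- ★ **In `K_v`: `(κ_v(res w))⁻¹ = a(w)`.** [cite: deShalit1987, II.1.7 (p. 41)] [cite: NeukirchANT1999, Ch. VI §5 Prop. (5.6)] -/
theorem coe_rayAdicCharacter_absGaloisRestrict_inv (h𝔪 : 𝔪 ≠ ⊥) (hv : ¬ 𝔪 ≤ v.asIdeal)
    (hw : ∀ u : (𝓞 K)ˣ, (u : 𝓞 K) - 1 ∈ 𝔪 → u = 1) (ha : IsLocalArtinMap (v.adicCompletion K) a)
    {w : WeilGroup (v.adicCompletion K)} (hwI : w ∈ WeilGroup.inertia (v.adicCompletion K)) :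
    ((((rayAdicCharacter h𝔪 hv hw ⟨absGaloisRestrict K (v.adicCompletion K)
        (WeilGroup.toAbsGalois (v.adicCompletion K) w),
      absGaloisRestrict_toAbsGalois_mem_ker_rayClassField h𝔪 hv ha hwI⟩)⁻¹ :
        (v.adicCompletionIntegers K)ˣ) : v.adicCompletionIntegers K) : v.adicCompletion K) =
      ((a w : (v.adicCompletion K)ˣ) : v.adicCompletion K) := by
  obtain ⟨u, hu⟩ := exists_unitsMap_eq_artin_of_mem_inertia ha hwI
  rw [rayAdicCharacter_absGaloisRestrict_eq_inv h𝔪 hv hw ha hwI hu, inv_inv, ← hu]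
  rfl

/-! ### §3. `κ_v⁻¹ = χ_π` on inertia (Lubin–Tate reciprocity) -/

open ValuativeRel in
/-- ★ **`κ_v(res w)⁻¹ = χ_π(w)` on the inertia group at `v`, for EVERY uniformiser `π` of `K_v`**: the ray
adic character (global, by `[·, K]`) and the Lubin–Tate character (local, by the action on the
`π^∞`-division points of the Lubin–Tate group `F_f`, `f ∈ 𝓕_π`) are inverse to each other on `I_{K_v}` —
de Shalit's `κ` (II.1.7: the action on `E[𝔭^∞]`, a Lubin–Tate group at the split prime) read in the tree's
conventions (`[·, K]`: prime ↦ arithmetic Frobenius; `χ_π = Art` on inertia,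
`coe_lubinTateChar_toAbsGalois_canonicalArtin`). With THE pinned Artin map `canonicalArtin K_v`.
[cite: deShalit1987, II.1.7 (p. 41), II.4.3 (p. 57)] [cite: LubinTate1965, Thm. 3]
[cite: CasselsFrohlichANT1967, Ch. VI §3.7 Thm. 3] -/
theorem coe_rayAdicCharacter_absGaloisRestrict_inv_eq_lubinTateChar (h𝔪 : 𝔪 ≠ ⊥)
    (hv : ¬ 𝔪 ≤ v.asIdeal) (hw : ∀ u : (𝓞 K)ˣ, (u : 𝓞 K) - 1 ∈ 𝔪 → u = 1)
    {π : 𝒪[v.adicCompletion K]} (hπ : (valuation (v.adicCompletion K)).IsUniformizer (π : v.adicCompletion K))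
    {w : WeilGroup (v.adicCompletion K)} (hwI : w ∈ WeilGroup.inertia (v.adicCompletion K)) :
    ((((rayAdicCharacter h𝔪 hv hw ⟨absGaloisRestrict K (v.adicCompletion K)
        (WeilGroup.toAbsGalois (v.adicCompletion K) w),
      absGaloisRestrict_toAbsGalois_mem_ker_rayClassField h𝔪 hv
        (isLocalArtinMap_canonicalArtin_holds (v.adicCompletion K)) hwI⟩)⁻¹ :
        (v.adicCompletionIntegers K)ˣ) : v.adicCompletionIntegers K) : v.adicCompletion K) =
      (((lubinTateChar hπ (WeilGroup.toAbsGalois (v.adicCompletion K) w) :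
        (𝒪[v.adicCompletion K])ˣ) : 𝒪[v.adicCompletion K]) : v.adicCompletion K) := by
  rw [coe_rayAdicCharacter_absGaloisRestrict_inv h𝔪 hv hw (isLocalArtinMap_canonicalArtin_holds _) hwI,
    coe_lubinTateChar_toAbsGalois_canonicalArtin hπ hwI]

end Literature.NumberTheory.NumberFields

end
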